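import Summits.Schanuel.Schanuel.Theses.RoyCriterion
import Literature.NumberTheory.Transcendental.RoySmallValueMain
import Summits.Schanuel.Schanuel.Theorems.RoyCriterionRoySmallValueDirichletGapDefs

/-!
# Route `RoyCriterion`, crux `RoySmallValueDirichletGap` (stmt-Schanuel-1050), line
# `two-sided-absorption-transfer` — stub `StubRichBodies`

**What is proved.** `stub_richBodies`: for `(ξ, η) ∈ ℂ × ℂˣ` and exponents `1 < τ < 2`, `τ < β`,
`0 < δ`, the small-value hypothesis `SmallValueHyp ξ η β τ ν` with `ν = 2 + β − τ + δ` implies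
`RichBodies ξ η β τ δ`: at every large level `D` there is an integer form `P̃_D ∈ ℤ[X₀,X₁,X₂]_D`,
divisible neither by `X₀` nor by `X₂`, all of whose derivatives `𝒟ʲP̃_D` (`j ≤ 2⌊D^τ⌋`) lie in
Roy's convex body `𝒞_D = royBody D ξ η (2D^β) (D^ν/2) ⌊D^τ⌋`.

**Informal statement (Roy 2013, §7, Step 1).** From the hypothesis polynomial `P_D ∈ ℤ[X₁,X₂]`
(`deg ≤ D`, height `≤ e^{D^β}`, `|𝒟₁ⁱP_D(ξ,η)| ≤ e^{−D^ν}` for `i < 3⌊D^τ⌋`) one forms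
`P̃_D(1, X₁, X₂) = X₁^a X₂^{−b} P_D(X₁, X₂)` of exact degree `D`; then `‖𝒟ʲP̃_D‖ ≤ e^{2D^β}` and
`|𝒟^{i+j}P̃_D(1,ξ,η)| ≤ e^{−D^ν/2}` (`i < ⌊D^τ⌋`, `j ≤ 2⌊D^τ⌋`) for `D` large, because
`D^{2⌊D^τ⌋}(D+1)² ≤ e^{D^β}` (`τ < β`) and `(2D+1)^{3⌊D^τ⌋} Mᴰ e^{−D^ν} ≤ e^{−D^ν/2}` (`τ < ν`,
`ν > 1`, `M = max(1,|ξ|)·max(1,|η|⁻¹)`).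

**Design.** This is `RoySmallValueMain.lean` (ll. 74–156) specialised: `P̃_D = royTilde D P_D`
(`RoySmallValueStep1`), the two thresholds `eventually_step1_norm` / `eventually_step1_value`
(`RoySmallValueThresholds`) feed `Roy2013.mem_body_of_step1` (`RoySmallValueMainPrelims`), and
`isHomogeneous_map_royTilde`, `map_royTilde_ne_zero`, `not_X_zero_dvd_royTilde`,
`not_X_two_dvd_royTilde` give the remaining clauses.  The hypothesis `τ < 2` (present in the crux and
in `TangentialTowerEmptiness`) is what makes `τ < ν = 2 + β − τ + δ`; `1 < τ < β` gives `0 < β`.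

## References

* [Roy2013] D. Roy, *A small value estimate for 𝔾ₐ × 𝔾ₘ*, Mathematika 59 (2013), 333–363
  (arXiv:1301.0663), §7.
-/

-- `Summit.Schanuel.Schanuel.…` is the mandated layout of this single-problem summit (CONVENTIONS §1).
set_option linter.dupNamespace false

noncomputable section

namespace Summit.Schanuel.Schanuel.Theorems.RoyLinks

open Filter MvPolynomial Finset Height
open Literature.NumberTheory.Transcendental
open Literature.NumberTheory.Transcendental.Roy2013
open Summit.Schanuel.Schanuel.Theses.RoyCriterion (RoySmallValueDirichletGap)

/-! ## Stub `StubRichBodies` -/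

/-- **Rich bodies (Roy 2013 §7 Step 1; stub of line `two-sided-absorption-transfer`).**  Under the
small-value hypothesis (`ν = 2 + β − τ + δ`, `1 < τ < 2`, `τ < β`, `δ > 0`), at every large level `D`
the integer form `P̃_D = royTilde D P_D` has degree `D`, is prime to `X₀` and `X₂`, and its
derivatives `𝒟ʲP̃_D`, `j ≤ 2⌊D^τ⌋`, lie in Roy's body `royBody D ξ η (2D^β) (D^ν/2) ⌊D^τ⌋`.
[cite: Roy2013, §7, Step 1] -/
theorem stub_richBodies (ξ η : ℂ) (hη : η ≠ 0) (β τ δ : ℝ) (h1 : 1 < τ) (h2 : τ < 2) (hβ : τ < β)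
    (hδ : 0 < δ) (hP : SmallValueHyp ξ η β τ (2 + β - τ + δ)) : RichBodies ξ η β τ δ := by
  /- exponents (`ν = 2 + β - τ + δ`) and the constant `M = max(1,|ξ|) max(1,|η|⁻¹)` -/
  have hβ0 : 0 < β := by linarith
  have hν1 : 1 < 2 + β - τ + δ := by linarith
  have hτν : τ < 2 + β - τ + δ := by linarith
  have hM1 : (1 : ℝ) ≤ max 1 ‖ξ‖ * max 1 ‖η‖⁻¹ :=
    one_le_mul_of_one_le_of_one_le (le_max_left _ _) (le_max_left _ _)
  /- the sequence of hypothesis polynomials `P_D`, `D ≥ D₀` -/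
  obtain ⟨D₀, hD₀⟩ := eventually_atTop.mp hP
  choose! P hP0 hPdeg hPht hPval using hD₀
  /- Step 1 at every large level: `P̃_D = royTilde D P_D` -/
  filter_upwards [eventually_ge_atTop (max D₀ 1), eventually_step1_norm hβ hβ0,
    eventually_step1_value hτν hν1 hM1] with D hD hE5 hE6
  have hD₀D : D₀ ≤ D := le_trans (le_max_left _ _) hD
  have hD1 : 1 ≤ D := le_trans (le_max_right _ _) hD
  exact ⟨royTilde D (hP0 D hD₀D), isHomogeneous_map_royTilde _ (hPdeg D hD₀D),
    map_royTilde_ne_zero _, not_X_zero_dvd_royTilde _ (hPdeg D hD₀D), not_X_two_dvd_royTilde _,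
    fun j hj => mem_body_of_step1 (hP0 D hD₀D) (hPdeg D hD₀D) hη hD1 j hj (hPht D hD₀D)
      (hPval D hD₀D) hE5 hE6⟩

end Summit.Schanuel.Schanuel.Theorems.RoyLinks

end
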